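import Summits.AtomisticToContinuum.Crystallization.Theses.PalmUnimodularRigidity
import Summits.AtomisticToContinuum.Crystallization.Theorems.MinimiserShells.Negative.LoadBearing
import Summits.AtomisticToContinuum.Crystallization.Theorems.MinimiserShells.Negative.Rootedness
import Literature.Probability.Process.PointStationaryLaw
import Literature.MathematicalPhysics.StatisticalMechanics.RootEnergy
import Literature.MathematicalPhysics.StatisticalMechanics.MuGSC
import Summits.AtomisticToContinuum.Crystallization.Theorems.PalmUnimodularRigidityMinimiserShellsEnergyFloorDefs

/-!
# Energy floor `e_uni ≥ e*` (route item 9229 `UnimodularEnergyLowerBound`), part B: the packing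
# class of hard-core configurations and the truncated configuration kernel — lemmas

Support file for stub `stub_energyFloor` (S2) of line `equilibrium-in-law-surgery` of crux
`MinimiserShells` (stmt-AtomisticToContinuum-9225), which discharges route item
stmt-AtomisticToContinuum-9229 `UnimodularEnergyLowerBound` ("e_uni ≥ e*": every point-stationary
hard-core probability law on rooted configurations of `ℝ³` has mean root energy `E_P[h] ≥ e*`).

* `hcClass δ` contains every counting measure of a `δ`-separated set (`count_restrict_mem_hcClass`),
  in particular every rooted `δ`-hard-core configuration and all its re-rootings
  (`mem_hcClass_of_hc`); its members give finite mass to bounded sets.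
* `measurable_lintegral_trunc`, `measurable_trunc_apply`: for a jointly measurable
  `k : α × ℝ³ → ℝ≥0∞`, the parametrised configuration sum `(μ, a) ↦ ∫⁻ z, k (a, z) ∂(trunc δ μ)` is
  JOINTLY measurable on `Measure ℝ³ × α` (the truncated kernel of `…EnergyFloorDefs` is s-finite,
  `Measurable.lintegral_kernel_prod_right`) — the measurability engine of every phase-dependent
  mass transport (over ALL measures joint measurability of `(μ, a) ↦ μ {z | (a, z) ∈ s}` is not
  available; on hard-core configurations the truncation changes nothing).
-/

noncomputable section

open MeasureTheory Filter ProbabilityTheory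
open scoped ENNReal BigOperators Topology

namespace Summit.AtomisticToContinuum.Crystallization.Theorems.PalmUnimodularRigidityMinimiserShells.EnergyFloor

open Literature.Probability.Process (IsRootedHardCore)
open Literature.MathematicalPhysics.StatisticalMechanics (UniformlyDiscrete card_le_of_separated_of_dist_le)

/-! ## Packing: the uniformly locally finite class -/

section Packing

variable {δ : ℝ} {S : Set (EuclideanSpace ℝ (Fin 3))}

/-- A `δ`-separated set meets a closed ball of radius `r ≥ 0` in at most `(2r/δ+1)³` points. -/
theorem ncard_inter_closedBall_le (hδ : 0 < δ)
    (hsep : ∀ x ∈ S, ∀ y ∈ S, x ≠ y → δ ≤ dist x y) (p : EuclideanSpace ℝ (Fin 3)) {r : ℝ}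
    (hr : 0 ≤ r) (T : Finset (EuclideanSpace ℝ (Fin 3)))
    (hT : (↑T : Set (EuclideanSpace ℝ (Fin 3))) ⊆ S ∩ Metric.closedBall p r) :
    (T.card : ℝ) ≤ (2 * r / δ + 1) ^ 3 := by
  have h := card_le_of_separated_of_dist_le T p hδ hr
    (fun c hc => Metric.mem_closedBall.1 (hT hc).2)
    (fun c hc d hd hcd => hsep c (hT hc).1 d (hT hd).1 hcd)
  simpa [finrank_euclideanSpace_fin] using h

/-- The counting measure of a `δ`-separated set gives a closed ball of radius `r ≥ 0` mass at most
`(2r/δ+1)³`. -/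
theorem count_restrict_closedBall_le (hδ : 0 < δ)
    (hsep : ∀ x ∈ S, ∀ y ∈ S, x ≠ y → δ ≤ dist x y) (p : EuclideanSpace ℝ (Fin 3)) {r : ℝ}
    (hr : 0 ≤ r) :
    (Measure.count : Measure (EuclideanSpace ℝ (Fin 3))).restrict S (Metric.closedBall p r) ≤
      ENNReal.ofReal ((2 * r / δ + 1) ^ 3) := by
  have hfin : (S ∩ Metric.closedBall p r).Finite :=
    UniformlyDiscrete.finite_inter_closedBall ⟨δ, hδ, hsep⟩ p r
  rw [Measure.restrict_apply measurableSet_closedBall, Set.inter_comm,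
    Measure.count_apply_finite _ hfin]
  have h := ncard_inter_closedBall_le hδ hsep p hr hfin.toFinset (by simp)
  calc ((hfin.toFinset.card : ℕ) : ℝ≥0∞) = ENNReal.ofReal (hfin.toFinset.card : ℝ) := by
        rw [ENNReal.ofReal_natCast]
    _ ≤ ENNReal.ofReal ((2 * r / δ + 1) ^ 3) := ENNReal.ofReal_le_ofReal h

/-- Counting measures of `δ`-separated sets are in the class. -/
theorem count_restrict_mem_hcClass (hδ : 0 < δ)
    (hsep : ∀ x ∈ S, ∀ y ∈ S, x ≠ y → δ ≤ dist x y) :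
    (Measure.count : Measure (EuclideanSpace ℝ (Fin 3))).restrict S ∈ hcClass δ :=
  fun n => count_restrict_closedBall_le hδ hsep 0 (Nat.cast_nonneg n)

/-- Rooted `δ`-hard-core configurations are in the class. -/
theorem mem_hcClass_of_hc (hδ : 0 < δ) {μ : Measure (EuclideanSpace ℝ (Fin 3))}
    (h : IsRootedHardCore δ μ) : μ ∈ hcClass δ := by
  obtain ⟨S, -, hsep, rfl⟩ := h
  exact count_restrict_mem_hcClass hδ hsep

/-- Members of the class give finite mass to bounded sets. -/
theorem measure_lt_top_of_mem_hcClass {μ : Measure (EuclideanSpace ℝ (Fin 3))} (hμ : μ ∈ hcClass δ)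
    {A : Set (EuclideanSpace ℝ (Fin 3))} {r : ℝ} (hA : A ⊆ Metric.closedBall 0 r) : μ A < ∞ := by
  calc μ A ≤ μ (Metric.closedBall 0 (⌈r⌉₊ : ℕ)) :=
        measure_mono (hA.trans (Metric.closedBall_subset_closedBall (Nat.le_ceil r)))
    _ ≤ packBound δ ⌈r⌉₊ := hμ _
    _ < ∞ := ENNReal.ofReal_lt_top

end Packing

/-! ## The truncated configuration kernel -/

section Trunc

variable {δ : ℝ}

/-- **Joint measurability of parametrised configuration sums**: for a jointly measurable kernel
`k`, `(μ, a) ↦ ∫⁻ z, k a z ∂(trunc δ μ)` is measurable on `Measure ℝ³ × α`. -/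
theorem measurable_lintegral_trunc {α : Type*} [MeasurableSpace α]
    {k : α → EuclideanSpace ℝ (Fin 3) → ℝ≥0∞} (hk : Measurable (Function.uncurry k)) :
    Measurable fun p : Measure (EuclideanSpace ℝ (Fin 3)) × α => ∫⁻ z, k p.2 z ∂(trunc δ p.1) := by
  have h := Measurable.lintegral_kernel_prod_right
    (κ := (truncKernel δ).comap (Prod.fst : Measure (EuclideanSpace ℝ (Fin 3)) × α → _) measurable_fst)
    (f := fun p z => k p.2 z) (hk.comp (measurable_fst.snd.prodMk measurable_snd))
  simpa [Kernel.comap_apply] using h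

/-- **Joint measurability of parametrised configuration counts**: for a measurable
`s ⊆ α × ℝ³`, `(μ, a) ↦ trunc δ μ {z | (a, z) ∈ s}` is measurable on `Measure ℝ³ × α`. -/
theorem measurable_trunc_apply {α : Type*} [MeasurableSpace α]
    {s : Set (α × EuclideanSpace ℝ (Fin 3))} (hs : MeasurableSet s) :
    Measurable fun p : Measure (EuclideanSpace ℝ (Fin 3)) × α => trunc δ p.1 {z | (p.2, z) ∈ s} := by
  have h := measurable_lintegral_trunc (δ := δ) (k := fun a z => s.indicator 1 (a, z))
    (measurable_one.indicator hs)
  have heq : (fun p : Measure (EuclideanSpace ℝ (Fin 3)) × α => trunc δ p.1 {z | (p.2, z) ∈ s}) =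
      fun p => ∫⁻ z, s.indicator 1 (p.2, z) ∂(trunc δ p.1) := by
    funext p
    change trunc δ p.1 (Prod.mk p.2 ⁻¹' s) = _
    rw [← lintegral_indicator_one (measurable_prodMk_left hs)]
    rfl
  rw [heq]
  exact h

end Trunc

end Summit.AtomisticToContinuum.Crystallization.Theorems.PalmUnimodularRigidityMinimiserShells.EnergyFloor

end
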